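import Summits.CriticalPhenomena.PercolationContinuityZ3.Theorems.PercNearOneGluingAdditiveGluingGenPair
import Literature.Probability.Percolation.KozmaNitzanSeparatingTriple
import HarnessLib

/-!
# Two-point covariance comparison: `Cov(F(C x), 1{x↔u}) · μ(x↮v) ≥ μ(u↔v, v↮x) · Cov(F(C x), 1{x↔v})`

Support file (`--supports stmt-CriticalPhenomena-4575`, closed crux; independent mathematics on Kozma–Nitzan's Question 8 at
`|A| = 3`), prover `prim-ineq-gen-6` (gen 14).  No definitions, no named facts, no sorries; standard axioms.
Memo `prim-ineq-gen-6/FINDING-G14.md` §5(g),(h): this is the `Y = ∅` case (TPC) of the minimal open model (UPZ₀'') of the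
centring side (UPZ)/PCOV-Z of the PCOV ∧ PCOV-Z certificate.

Setting: one percolation `μ = prodBernoulli w`, owner `x`, two marked vertices `u, v`, `F` monotone nonnegative on vertex sets,
`f = F(C x)`, `m = ∫ f`; cells `O = {x↔u}`, `D = {x↮v}`, `R = D ∩ {v↔u}` (`= {u↔v, v↮x}`).
* `PocketCert.twoPoint_covComparison` — `μ(R) · (μ(D)·m − ∫_D f) ≤ μ(D) · (∫_O f − μ(O)·m)`, i.e. (since `μ(D) m − ∫_D f
  = ∫_{x↔v} f − μ(x↔v) m`)   `Cov(F(C x), 1{u ∈ C x}) ≥ μ(u↔v | v↮x) · Cov(F(C x), 1{v ∈ C x})`: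
  for EVERY increasing functional of the cluster, the covariance with the membership of `u` is at least `P(u↔v | v↮x)` times the
  covariance with the membership of `v`.  At `F = 1{v ∈ ·}` it is the scalar merge-domination
  `P(u↔x | v↔x) ≥ P(u ↔ {x,v} | v↮x)`.  Sibling of `PocketCert.strong_fourPoint` (there the conditioning cell is `{x↮u, x↮v}`).
  PROOF: Harris for the increasing event `O ⊔ R = {u↔x} ∪ {u↔v}` (`AGloc.setIntegral_clusterFun_ge`) gives
  `∫_O f − μ(O) m ≥ μ(R) m − ∫_R f`; van den Berg–Häggström–Kahn's Theorem 1.4/2.1 at `q = 1` for `S = {x}`, `T = {v}`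
  (`BHK2006_twoSetConditionalAssociation.negCorrelation`: given `D = {x↮v}`, `F(C x)` and `1{v↔u}` are negatively correlated) gives
  `μ(D) ∫_R f ≤ μ(R) ∫_D f`; multiply the first by `μ(D)` and insert the second.
Census: exact rational verification of the statement and of both rows over ALL up-sets `F` on 60 random instances (`n ≤ 6`;
lab-g14/s_tpc.py): 0 negatives; the second row is an equality at `F = 1{v ∈ ·}` in every instance.
[cite: VandenbergHaggstromKahn2005, Thm. 1.4 (p. 7), Thm. 2.1 (p. 9), §1 p. 6] [cite: KozmaNitzan2024, Question 8 (§5.5 p. 36)]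
-/

namespace Summit.CriticalPhenomena.PercolationContinuityZ3.Theorems

open MeasureTheory Set Literature.Probability.LatticeModels Literature.Probability.Percolation
open scoped Classical
open KNPreFKG

noncomputable section

namespace PocketCert

variable {V : Type*} [Fintype V]

/-- **Two-point covariance comparison (TPC).**  Owner `x`, marked vertices `u, v`, `F` monotone nonnegative on vertex sets;
`O = {x↔u}`, `D = {x↮v}`, `R = D ∩ {v↔u}`.  Then
`μ(R) · (μ(D) · ∫ F(C x) − ∫_D F(C x)) ≤ μ(D) · (∫_O F(C x) − μ(O) · ∫ F(C x))`,
i.e. `Cov(F(C x), 1{x↔u}) ≥ μ(u↔v | v↮x) · Cov(F(C x), 1{x↔v})`.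
Harris on `{u↔x} ∪ {u↔v}` plus vdBHK Thm 1.4/2.1 (`q = 1`, `S = {x}`, `T = {v}`).
[cite: VandenbergHaggstromKahn2005, Thm. 1.4 (p. 7), Thm. 2.1 (p. 9)] -/
theorem twoPoint_covComparison (w : Sym2 V → unitInterval) (x u v : V) (F : Set V → ℝ)
    (hF : ∀ S T : Set V, S ⊆ T → F S ≤ F T) (hF0 : ∀ S, 0 ≤ F S) :
    (prodBernoulli w).real ({ω : BondConfig V | ¬ (openGraph ω).Reachable x v} ∩ openConn v u) *
        ((prodBernoulli w).real {ω : BondConfig V | ¬ (openGraph ω).Reachable x v} *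
            ∫ ω, F (openCluster ω x) ∂(prodBernoulli w) -
          ∫ ω in {ω : BondConfig V | ¬ (openGraph ω).Reachable x v}, F (openCluster ω x) ∂(prodBernoulli w)) ≤
      (prodBernoulli w).real {ω : BondConfig V | ¬ (openGraph ω).Reachable x v} *
        (∫ ω in openConn x u, F (openCluster ω x) ∂(prodBernoulli w) -
          (prodBernoulli w).real (openConn x u) * ∫ ω, F (openCluster ω x) ∂(prodBernoulli w)) := by
  classical
  set μ := prodBernoulli w with hμ
  set f : BondConfig V → ℝ := fun ω => F (openCluster ω x) with hf
  have hmeas : ∀ S' : Set (BondConfig V), MeasurableSet S' := fun _ => MeasurableSet.of_discrete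
  have hint : ∀ (g : BondConfig V → ℝ) (S' : Set (BondConfig V)), IntegrableOn g S' μ :=
    fun g S' => (Integrable.of_finite).integrableOn
  have hn := fun (S' : Set (BondConfig V)) => (measureReal_nonneg : 0 ≤ μ.real S')
  -- cells
  set O : Set (BondConfig V) := openConn x u with hO
  set D : Set (BondConfig V) := {ω : BondConfig V | ¬ (openGraph ω).Reachable x v} with hD
  set R : Set (BondConfig V) := D ∩ openConn v u with hR
  set U : Set (BondConfig V) := openConn x u ∪ openConn v u with hU
  set m : ℝ := ∫ ω, f ω ∂μ with hm
  -- `U = O ⊔ R`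
  have hUeq : U = O ∪ R := by
    ext ω
    simp only [hU, hO, hR, hD, mem_inter_iff, mem_union, mem_setOf_eq, openConn]
    constructor
    · rintro (hxu | hvu)
      · exact Or.inl hxu
      · by_cases hxv : (openGraph ω).Reachable x v
        · exact Or.inl (hxv.trans hvu)
        · exact Or.inr ⟨hxv, hvu⟩
    · rintro (hxu | ⟨-, hvu⟩)
      · exact Or.inl hxu
      · exact Or.inr hvu
  have hdOR : Disjoint O R := by
    rw [Set.disjoint_left]
    rintro ω hxu ⟨hxv, hvu⟩
    exact hxv (hxu.trans hvu.symm)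
  have eU : μ.real U = μ.real O + μ.real R := by rw [hUeq, measureReal_union hdOR (hmeas _)]
  have iU : ∫ ω in U, f ω ∂μ = ∫ ω in O, f ω ∂μ + ∫ ω in R, f ω ∂μ := by
    rw [hUeq, setIntegral_union hdOR (hmeas _) (hint _ _) (hint _ _)]
  -- (1) Harris on `U = {x↔u} ∪ {v↔u}`
  have hHarris : μ.real U * m ≤ ∫ ω in U, f ω ∂μ :=
    AGloc.setIntegral_clusterFun_ge w x F hF hF0 U ((isUpperSet_openConn x u).union (isUpperSet_openConn v u))
  -- (2) van den Berg–Häggström–Kahn Thm 2.1 for `S = {x}`, `T = {v}`: `F(C x)` vs `1{v↔u}` given `x ↮ v`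
  set S : Set V := {x} with hS
  set T : Set V := {v} with hT
  set Fe : Set (Sym2 V) → ℝ := fun C => F (openCluster C x) with hFe
  set Ge : Set (Sym2 V) → ℝ := fun C => if (openGraph C).Reachable v u then 1 else 0 with hGe
  have hFe_mono : Monotone Fe := fun C C' hCC' => hF _ _ (openCluster_mono hCC' x)
  have hGe_mono : Monotone Ge := by
    intro C C' hCC'
    simp only [hGe]
    by_cases h : (openGraph C).Reachable v u
    · rw [if_pos h, if_pos (h.mono (openGraph_mono hCC'))]
    · rw [if_neg h]; split_ifs <;> norm_num
  have hD_ST : {ω : BondConfig V | ∀ s ∈ S, ∀ t ∈ T, ¬ (openGraph ω).Reachable s t} = D := by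
    ext ω
    simp only [hS, hT, hD, mem_setOf_eq, mem_singleton_iff, forall_eq]
  have hFe_eq : ∀ ω : BondConfig V, Fe (⋃ s ∈ S, openEdgeCluster ω s) = f ω := by
    intro ω
    simp only [hFe, hf]
    congr 1
    ext a
    exact (KNSep.reachable_iff_cluster ω S (show x ∈ S by simp [hS]) a).symm
  have hGe_eq : ∀ ω : BondConfig V, Ge (⋃ t ∈ T, openEdgeCluster ω t) = (openConn v u : Set (BondConfig V)).indicator 1 ω := by
    intro ω
    simp only [hGe]
    rw [← KNSep.reachable_iff_cluster ω T (show v ∈ T by simp [hT]) u]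
    by_cases h : (openGraph ω).Reachable v u
    · rw [if_pos h, indicator_of_mem (show ω ∈ openConn v u from h), Pi.one_apply]
    · rw [if_neg h, indicator_of_notMem (show ω ∉ openConn v u from h)]
  have hBHK := BHK2006_twoSetConditionalAssociation.negCorrelation w S T Fe Ge hFe_mono hGe_mono
  rw [hD_ST] at hBHK
  simp_rw [hFe_eq, hGe_eq] at hBHK
  rw [setIntegral_mul_indicator_one μ D (openConn v u) f, setIntegral_indicator_one_eq μ D (openConn v u)] at hBHK
  -- hBHK : μ D * ∫_R f ≤ (∫_D f) * μ R     (R = D ∩ {v↔u})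
  change μ.real D * ∫ ω in R, f ω ∂μ ≤ (∫ ω in D, f ω ∂μ) * μ.real R at hBHK
  -- assemble: μ(D)·(∫_O f − μ(O) m) ≥ μ(D)·(μ(R) m − ∫_R f) ≥ μ(R)·(μ(D) m − ∫_D f)
  rw [iU, eU] at hHarris
  have hA : ∫ ω in O, f ω ∂μ - μ.real O * m ≥ μ.real R * m - ∫ ω in R, f ω ∂μ := by linarith
  have hC := mul_le_mul_of_nonneg_left hA (hn D)
  nlinarith [hBHK, hC, hn D, hn R]

end PocketCert

end

end Summit.CriticalPhenomena.PercolationContinuityZ3.Theorems
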